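import Summits.BirchSwinnertonDyer.Rank1Residual.X11b.LocalTorsionMultiplicative
import HarnessLib

/-!
# CAVEAT in the kernel: the tree's `frobeniusTrace` is `2` / `0` at a split / non-split multiplicative prime (not Silverman's `a_p = ±1`)

HONEST FRAMING (cell `b2b-bsdres`, run/shared/lean/b2b/bsd-rank1-residual/, verbatim in every
file): the goal of the cell is to DELETE the COMBINATION-SHAPED residual classes of the
Birch–Swinnerton-Dyer formula for ALL analytic-rank `≤ 1` elliptic curves over `ℚ` — "full BSD
formula for every rank `≤ 1` curve in class `C`" assembled STRICTLY from published theorems — so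
that the rank-`≤ 1` remainder becomes exactly the CONSTRUCTION-SHAPED classes, which are TYPED
(missing-input `Prop`s), NOT attempted. This is not "finishing BSD". Sub-cell
`b2b-bsdres-multr1-p1` (X11b, route R1); no claim beyond the stated class; X11b stays
CONSTRUCTION-SHAPED; nothing here changes a label; no named fact (theorems only; no `sorry`).

## What this file records

The tree's `WeierstrassCurve.frobeniusTrace W p := p + 1 − reductionPointCount W p`
(`GlobalMinimalModel.lean`), where `reductionPointCount W p = Nat.card` of Mathlib's points of
`integralModelInt W` modulo `p` — the NONSINGULAR affine points plus `O`. At a prime of good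
reduction this is `a_p`. At a prime of multiplicative reduction Mathlib's point type is
`Ẽ_ns(𝔽_p) ≅ 𝔽_p^×` (split) resp. the norm-one torus of `𝔽_{p²}` (non-split), of order `p − 1`
resp. `p + 1` INCLUDING `O` (Silverman, *AEC* Ex. 3.5; tree `reductionPointCount_of_mult`, gen 6
`LocalTorsionMultiplicative.lean`), so

  `frobeniusTrace W p = 2` at a split multiplicative `p`, `= 0` at a non-split one,

and NOT Silverman's `a_p = +1` / `−1` (*AEC* VII, App. C §16: `a_p = p + 1 − #Ẽ(𝔽_p)` counting ALL
points of the singular cubic, `#Ẽ(𝔽_p) = #Ẽ_ns(𝔽_p) + 1`). The docstring of `reductionPointCount`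
("`= #Ẽ_ns(𝔽_p) + 1 = p + 1 − a_p` with `a_p ∈ {0, 1, −1}`") is therefore off by one at bad primes
— harmless for the cell (`GoodOrd`, `GoodSS`, `Anom`, `Skinner2016.thmC…`'s `p ∤ a_p` and
`LFunction_apply_prime_eq_frobeniusTrace` all carry good reduction at `p`) but worth recording next
to its first users; companion of the tree's `frobeniusTrace_eq_one_of_hasAdditiveReductionAt`.
These two lemmas were first proposed as an append to `LocalTorsionMultiplicative.lean` (p212364,
gen 6), which never reached verification in the gate's append queue; they are re-derived here in a
file of their own.

* `frobeniusTrace_eq_two_of_split`, `frobeniusTrace_eq_zero_of_nonsplit`,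
  `frobeniusTrace_ne_one_and_ne_neg_one_of_mult`.

References: J. H. Silverman, *The Arithmetic of Elliptic Curves*, 2nd ed. (2009), Ex. 3.5, VII.5,
App. C §16 [SilvermanAEC2009]; B. Conrad, *Conductors* (2005) (the convention `N_p`) [Conrad2005].
-/

noncomputable section

open scoped Classical

namespace Summit.BirchSwinnertonDyer.Rank1Residual.X11b.LocalTorsion

open WeierstrassCurve Literature.NumberTheory.EllipticCurves
  Literature.NumberTheory.EllipticCurves.Rank1Residual

variable (W : WeierstrassCurve ℚ) [W.IsElliptic] [W.IsGloballyMinimal] (p : ℕ) [hp : Fact p.Prime]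

/-- **At a SPLIT multiplicative prime the tree's `frobeniusTrace` is `2`** (`#Ẽ_ns(𝔽_p) = p − 1`
including `O`; Silverman's `a_p` would be `+1`). [cite: SilvermanAEC2009, Exercise 3.5 (PDF p. 97)] -/
theorem frobeniusTrace_eq_two_of_split (hmult : Mult W p)
    (hs : W.HasSplitMultiplicativeReductionAtPrime p) : W.frobeniusTrace p = 2 := by
  have h := (reductionPointCount_of_mult W p hmult).1 hs
  unfold WeierstrassCurve.frobeniusTrace
  have : (reductionPointCount W p : ℤ) + 1 = p := by exact_mod_cast h
  omega

/-- **At a NON-SPLIT multiplicative prime the tree's `frobeniusTrace` is `0`** (`#Ẽ_ns(𝔽_p) = p + 1`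
including `O`; Silverman's `a_p` would be `−1`). [cite: SilvermanAEC2009, Exercise 3.5 (PDF p. 97)] -/
theorem frobeniusTrace_eq_zero_of_nonsplit (hmult : Mult W p)
    (hns : ¬ W.HasSplitMultiplicativeReductionAtPrime p) : W.frobeniusTrace p = 0 := by
  have h := (reductionPointCount_of_mult W p hmult).2 hns
  unfold WeierstrassCurve.frobeniusTrace
  have : (reductionPointCount W p : ℤ) = p + 1 := by exact_mod_cast h
  omega

/-- **The caveat**: at a multiplicative prime the tree's `frobeniusTrace` is never Silverman's
`a_p ∈ {+1, −1}`. [cite: SilvermanAEC2009, Exercise 3.5 (PDF p. 97)] -/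
theorem frobeniusTrace_ne_one_and_ne_neg_one_of_mult (hmult : Mult W p) :
    W.frobeniusTrace p ≠ 1 ∧ W.frobeniusTrace p ≠ -1 := by
  by_cases hs : W.HasSplitMultiplicativeReductionAtPrime p
  · rw [frobeniusTrace_eq_two_of_split W p hmult hs]; norm_num
  · rw [frobeniusTrace_eq_zero_of_nonsplit W p hmult hs]; norm_num

end Summit.BirchSwinnertonDyer.Rank1Residual.X11b.LocalTorsion

end
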